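import Mathlib
import Literature.AlgebraicGeometry.Resolution.KummerToricEmbedding
import Literature.AlgebraicGeometry.Resolution.RegularParameterFamilies
import Summits.ResolutionOfSingularities.ResolutionOfSingularities.Theorems.PAlterationPicoverLocalModelWoundTwistIntegralClosure
import Summits.ResolutionOfSingularities.ResolutionOfSingularities.Theorems.PAlterationPicoverLocalModelTransversalExit

/-!
# Crux `PicoverLocalModel` (stmt-ResolutionOfSingularities-0557), line `SketchIdeator3`
# (giraud-cossart-normal-form) — endgame, local charts: at a Kummer point the integral
# closure of the model is the Kummer toric algebra

Helper of the stub `stub_localCharts`. Let `O` be a regular local ring of characteristic `p`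
with boundary equations `x_1, …, x_r ∈ 𝔪` independent modulo `𝔪²`, and let the radicand be in
TWISTED Kummer form

  `a - g^p = u₁^p · ∏ x_j^{A_j}`,  `u₁ ≠ 0`,  `c₀ A_{j₀} ≡ 1 (mod p)`

(reached from Giraud's Kummer form `a = g^p + v x^A`, `p ∤ A_{j₀}`, by the Kummer twist
`x_{j₀} ↦ v^{c₀} x_{j₀}`, `u₁ = v^{-m₀}`, `c₀ A_{j₀} = 1 + p m₀`, `KummerTwist`). With
`c_j = c₀ A_j mod p` (so `c_{j₀} = 1`) and the model `A' = O[t]/(t^p - a)` a domain, the element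
`τ = ((t - g)/u₁)^{c₀} / x^{⌊c₀ A/p⌋} ∈ Frac A'` satisfies `τ^p = x^c`, and the embedding
`ψ : T → Frac A'` of the Kummer toric algebra `T = toric p x j₀ c`
(`Literature/…/KummerToricEmbedding.lean`) has image EXACTLY the integral closure of `A'`
(`integralClosure_model_eq_range_toric`): `T` is an integrally closed domain integral over `O`
(`toric_structure`), and its image contains `t = g + u₁ x^{⌊A/p⌋} ψ(s^{A mod p})`
(Frobenius-injectivity). Hence the local ring of the normalised `p`-cyclic cover at the point
over a Kummer point is the toric algebra `T` — local, normal, with `T/I ≅ O/(x)` regular and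
the Kummer chart log regular at its closed point (`KummerChartLogRegular.lean`).
-/

noncomputable section

-- single-problem summit: the doubled namespace component `ResolutionOfSingularities` is the tree layout
set_option linter.dupNamespace false

open IsLocalRing Polynomial Literature.AlgebraicGeometry.Resolution

namespace Summit.ResolutionOfSingularities.ResolutionOfSingularities.Theorems.PicoverLocalModel.LocalCharts

/-- `t^p = a` in `O[t]/(t^p - a)`. [folklore] -/
theorem root_pow_eq_of {O : Type*} [CommRing O] (p : ℕ) (a : O) :
    AdjoinRoot.root ((X : O[X]) ^ p - C a) ^ p = AdjoinRoot.of ((X : O[X]) ^ p - C a) a := by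
  have h := AdjoinRoot.eval₂_root ((X : O[X]) ^ p - C a)
  rw [eval₂_sub, eval₂_X_pow, eval₂_C, sub_eq_zero] at h
  exact h

/-- The structure map `O → O[t]/(t^p - a)` is injective (`0 < p`). [folklore] -/
theorem of_injective {O : Type*} [CommRing O] [Nontrivial O] (p : ℕ) (hp : 0 < p) (a : O) :
    Function.Injective (AdjoinRoot.of ((X : O[X]) ^ p - C a)) := by
  have hmonic : ((X : O[X]) ^ p - C a).Monic := monic_X_pow_sub_C a hp.ne'
  intro b₁ b₂ hb
  rw [← sub_eq_zero, ← map_sub] at hb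
  by_contra hne
  have hne' : b₁ - b₂ ≠ 0 := sub_ne_zero.mpr hne
  change AdjoinRoot.mk _ (C (b₁ - b₂)) = 0 at hb
  rw [AdjoinRoot.mk_eq_zero] at hb
  refine hmonic.not_dvd_of_natDegree_lt (C_ne_zero.mpr hne') ?_ hb
  rw [natDegree_C, natDegree_X_pow_sub_C]
  exact hp

/-- **At a (twisted) Kummer point, the integral closure of the model is the Kummer toric
algebra.** See the module docstring. [cite: Kato1994, (2.2)(2) and Thm. (4.1)] -/
theorem integralClosure_model_eq_range_toric : ∀ {O : Type*} [CommRing O] [IsRegularLocalRing O] (p : ℕ) [Fact p.Prime] [CharP O p] {r : ℕ} (x : Fin r → O), (∀ j, x j ∈ IsLocalRing.maximalIdeal O) → (∀ α : Fin r → O, ∑ i, α i * x i ∈ IsLocalRing.maximalIdeal O ^ 2 → ∀ i, α i ∈ IsLocalRing.maximalIdeal O) → ∀ (j₀ : Fin r) (A : Fin r → ℕ) (c₀ : ℕ), c₀ * A j₀ % p = 1 → ∀ (a g u₁ : O), u₁ ≠ 0 → a - g ^ p = u₁ ^ p * ∏ j, x j ^ A j → ∀ [IsDomain (AdjoinRoot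 ((Polynomial.X : Polynomial O) ^ p - Polynomial.C a))], ∃ ψ : RootCover.toric p x j₀ (fun j => c₀ * A j % p) →ₐ[O] FractionRing (AdjoinRoot ((Polynomial.X : Polynomial O) ^ p - Polynomial.C a)), Function.Injective ψ ∧ (integralClosure (AdjoinRoot ((Polynomial.X : Polynomial O) ^ p - Polynomial.C a)) (FractionRing (AdjoinRoot ((Polynomial.X : Polynomial O) ^ p - Polynomial.C a)))).toSubring = ψ.toRingHom.range ∧ ∀ n : {n : Fin r → Fin p // RootCover.IsKummerExp p j₀ (fun j => c₀ * A j % p) n}, ψ (RootCover.kummerMonomial p x j₀ (fun j => c₀ * A j % p) n) * algebraMap O _ (∏ j, x j ^ ((n.1 j₀ : ℕ) * (c₀ * A j % p) / p)) = ((algebraMap (AdjoinRoot ((Polynomial.X : Polynomial O) ^ p - Polynomial.C a)) (FractionRing (AdjoinRoot ((Polynomial.X : Polynomial O) ^ p - Polynomial.C a))) (AdjoinRoot.root _ - AdjoinRoot.of _ g) / algebraMap O _ u₁) ^ c₀ / algebraMap O _ (∏ j, x j ^ (c₀ * A j / p))) ^ (n.1 j₀ : ℕ) := by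
  intro O _ _ p _ _ r x hx hli j₀ A c₀ hc₀ a g u₁ hu₁ ha _
  have hp : p.Prime := Fact.out
  set f : O[X] := X ^ p - C a with hf
  set c : Fin r → ℕ := fun j => c₀ * A j % p with hcdef
  have hc : c j₀ = 1 := hc₀
  let A' := AdjoinRoot f
  let K := FractionRing A'
  haveI := isDomain_of_isRegularLocalRing O
  -- injectivity of the structure maps
  have hinjA : Function.Injective (algebraMap O A') := of_injective p hp.pos a
  have hinj : Function.Injective (algebraMap O K) := by
    rw [IsScalarTower.algebraMap_eq O A' K, RingHom.coe_comp]
    exact (IsFractionRing.injective A' K).comp hinjA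
  haveI : CharP A' p := charP_of_injective_algebraMap hinjA p
  have hx0 : ∀ j, x j ≠ 0 := fun j h0 =>
    RegularParameters.notMem_sq hli j (h0 ▸ Ideal.zero_mem _)
  -- the root cover is a domain
  obtain ⟨hregB, -⟩ := RootCover.isRegularLocalRing (p := p) hx hli
  haveI := hregB
  haveI := isDomain_of_isRegularLocalRing (RootCover p x)
  -- the element `τ`
  set w : K := algebraMap A' K (AdjoinRoot.root f - AdjoinRoot.of f g) with hw
  set τ : K := (w / algebraMap O K u₁) ^ c₀ / algebraMap O K (∏ j, x j ^ (c₀ * A j / p)) with hτdef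
  have hwp : w ^ p = algebraMap O K (u₁ ^ p * ∏ j, x j ^ A j) := by
    rw [hw, ← map_pow, sub_pow_char, root_pow_eq_of, ← map_pow, ← map_sub, ← ha]
    exact (IsScalarTower.algebraMap_apply O A' K _).symm
  have hu₁K : algebraMap O K u₁ ≠ 0 := (map_ne_zero_iff _ hinj).mpr hu₁
  have hτ : τ ^ p = algebraMap O K (∏ j, x j ^ c j) := by
    have hden := RootCover.algebraMap_prod_pow_ne_zero (K := K) hx0 hinj (fun j => c₀ * A j / p)
    rw [hτdef, div_pow, ← pow_mul, mul_comm c₀ p, pow_mul, div_pow, hwp, map_mul, map_pow,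
      mul_div_cancel_left₀ _ (pow_ne_zero _ hu₁K), div_eq_iff (pow_ne_zero _ hden), ← map_pow,
      ← map_pow, ← map_mul]
    congr 1
    rw [← Finset.prod_pow, ← Finset.prod_pow, ← Finset.prod_mul_distrib]
    refine Finset.prod_congr rfl fun j _ => ?_
    rw [← pow_mul, ← pow_mul, ← pow_add]
    congr 1
    rw [hcdef]
    simp only
    rw [mul_comm (A j) c₀, Nat.mod_add_div']
  -- the embedding
  obtain ⟨ψ, hψinj, hψ⟩ := RootCover.exists_algHom_toric (p := p) (x := x) (j₀ := j₀) (c := c)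
    hx0 hinj τ hτ
  -- structure of the toric algebra
  obtain ⟨_, _, hic, -, -⟩ := RootCover.toric_structure (p := p) (x := x) (j₀ := j₀) (c := c) hx hli
  haveI := hic
  haveI : Algebra.IsIntegral O (RootCover.toric p x j₀ c) := inferInstance
  haveI : Algebra.IsIntegral O A' :=
    haveI := (monic_X_pow_sub_C a hp.ne_zero).finite_adjoinRoot; inferInstance
  refine ⟨ψ, hψinj, WoundTwistIntegralClosure.integralClosure_eq_range_of_isIntegrallyClosed ψ hψinj ?_, ?_⟩
  · -- the image contains `A' = O[t]`: it suffices that it contains `t`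
    -- the Kummer exponent `A mod p`
    let nA : Fin r → Fin p := fun j => ⟨A j % p, Nat.mod_lt _ hp.pos⟩
    have hnA : RootCover.IsKummerExp p j₀ c nA := by
      intro j
      simp only [nA, ZMod.natCast_mod, hcdef]
      have h1 : ((c₀ * A j₀ : ℕ) : ZMod p) = 1 := by
        rw [← ZMod.natCast_mod, hc₀, Nat.cast_one]
      rw [Nat.cast_mul] at h1
      calc ((A j : ℕ) : ZMod p) = (A j : ZMod p) * ((c₀ : ZMod p) * (A j₀ : ZMod p)) := by
            rw [h1, mul_one]
        _ = (c₀ : ZMod p) * (A j : ZMod p) * (A j₀ : ZMod p) := by ring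
        _ = ((c₀ * A j : ℕ) : ZMod p) * (A j₀ : ZMod p) := by rw [Nat.cast_mul]
    -- `w = u₁ · x^{A / p} · ψ(s^{A mod p})`
    have hwψ : w = algebraMap O K u₁ * algebraMap O K (∏ j, x j ^ (A j / p)) *
        ψ (RootCover.kummerMonomial p x j₀ c ⟨nA, hnA⟩) := by
      haveI : CharP K p := charP_of_injective_algebraMap hinj p
      apply frobenius_inj K p
      rw [frobenius_def, frobenius_def, mul_pow, mul_pow, hwp, hψ ⟨nA, hnA⟩,
        RootCover.psi0_pow hx0 hinj τ hτ ⟨nA, hnA⟩, ← map_pow, ← map_pow, ← map_mul, ← map_mul]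
      congr 1
      rw [mul_assoc]
      congr 1
      rw [← Finset.prod_pow, ← Finset.prod_mul_distrib]
      refine Finset.prod_congr rfl fun j _ => ?_
      rw [← pow_mul, ← pow_add]
      congr 1
      simp only [nA]
      rw [mul_comm, Nat.div_add_mod]
    have hroot : algebraMap A' K (AdjoinRoot.root f) ∈ ψ.range := by
      have : algebraMap A' K (AdjoinRoot.root f) = w + algebraMap O K g := by
        rw [hw, map_sub, IsScalarTower.algebraMap_apply O A' K g]
        exact (sub_add_cancel _ _).symm
      rw [this, hwψ]
      refine Subalgebra.add_mem _ (Subalgebra.mul_mem _ (Subalgebra.mul_mem _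
        (Subalgebra.algebraMap_mem _ _) (Subalgebra.algebraMap_mem _ _)) ⟨_, rfl⟩)
        (Subalgebra.algebraMap_mem _ _)
    rintro _ ⟨a', rfl⟩
    obtain ⟨g', rfl⟩ := AdjoinRoot.mk_surjective a'
    have hz : algebraMap A' K (AdjoinRoot.mk f g') ∈ ψ.range := by
      rw [← AdjoinRoot.aeval_eq, ← IsScalarTower.coe_toAlgHom' O A' K,
        ← Polynomial.aeval_algHom_apply]
      exact Algebra.adjoin_le (Set.singleton_subset_iff.mpr hroot)
        (Polynomial.aeval_mem_adjoin_singleton O _)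
    obtain ⟨tt, htt⟩ := hz
    exact ⟨tt, htt⟩
  · intro n
    rw [hψ n, div_mul_cancel₀]
    exact RootCover.algebraMap_prod_pow_ne_zero hx0 hinj _

end Summit.ResolutionOfSingularities.ResolutionOfSingularities.Theorems.PicoverLocalModel.LocalCharts

end
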